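import Summits.HodgeConjecture.HodgeConjecture.Theorems.F0P3cXiArchPinnedOfThetaDictionary  -- ★ p847996 (LH1-p03): `stubS2sharpTheta_archPinned` (S2♯'s conclusion on the theta locus, hypothesis-free)
import Summits.HodgeConjecture.HodgeConjecture.Theorems.F0P3cMemXiFamilyRigidOfCot          -- ★ p847744 (LH1-p02): U♭-cot `memXiFamily_rigid_of_isCot`
import HarnessLib

/-!
# Crux `H413`, line LH1 — THE THREE ORGAN TEXTS OF THE S2♯ PAY-DOWN LINE HOLD ON THE THETA LOCUS (regression witnesses, hypothesis-free)

Cell `hodgecm-mathlib`, F0∕P3c line LH1 (closer stub `stub_S2sharp` of `Cruxes/H413/Lines/F0_U3LettersRung1.lean` ED. 38 = books row #80 S2♯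
★ `Rogawski1990.cohDiscrete_memXiFamily_archPinned`), crux item `stmt-HodgeConjecture-24833`; LH1-p04 (g0) on LH1-plan (g0)'s DEALS ROUND 2
(2026-09-02T02:25:21Z, hand (h2)).  PROOF lane: THEOREMS ONLY (no `def`, no instance declaration, no notation, no named fact, no `sorry`); never imports a
`Cruxes/…/Lines` module; `--supports stmt-HodgeConjecture-24833 --as helper`.  HONEST LABEL: HC_CM is proved only modulo the 7 printed citations (2 remaining:
hLiu418 = stmt-HodgeConjecture-24832, h413 = stmt-HodgeConjecture-24833) until rung 0 closes; this file pays NO printed row — the organs FIN ∕ PIN-ι ∕ PIN-τ of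
the pay-down LEAF `Cruxes/H413/Lines/F0_P3c_S2SharpPaydown.lean` (10355e03d0b94504) stay rung-5 print for a GENERAL cotangent `P`.

WHAT IS PROVED.  The LEAF cuts S2♯ into ORGAN FIN `S2FinLetter` (∃ ξ, `MemXiFamily P … ξ`), ORGAN PIN-ι `S2PinIotaLetter` (∀ ξ in the family of `P`,
`ξ.IsCohTrivialAt (tOfArchType k₀ ι) ι`) and ORGAN PIN-τ `S2PinCompactLetter` (∀ ξ in the family, ∀ τ off the place of `ι`, `ξ.IsCohTrivialAt (tOfArchType k₀ τ) τ`),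
`k₀ = archTypeOfRecord μω` (★ `F0P3XiArchDataOfRecord`).  The card's A5 risk for the two `∀ ξ`-organs is a SIGN-CONVENTION mismatch between ★ `MemXiFamily`'s labels
and ★ `ArchSignRecipe.tOfArchType`.  On the THETA LOCUS — `P` has the finite component `ω_H(μ, a, χ)` of a rational theta frame (★ `HasFinComponent (rhoAtLine …)`, the
binders of ★ `F0P2uS2SharpTheta.stubS2sharpTheta_holds` verbatim) — the one-dimensional `ξ` is EXPLICIT (the forward dictionary of ★ `F0P2uXiOfThetaDatum`), lies in the
family of `P` (★ p845234) and is archimedean-pinned at EVERY embedding by pure Hecke-character arithmetic (★ LH1-p03 `stubS2sharpTheta_archPinned`, p847996); by U♭ on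
the cotangent locus (★ LH1-p02 `memXiFamily_rigid_of_isCot`, p847744) EVERY `ξ` of the family of a cotangent theta-`P` is that one.  Hence each organ TEXT, with the
theta binders inserted after `P` and otherwise token for token (the LEAF's measure `μ` is spelled `μA` here because the theta datum carries a character `μ`), is a
THEOREM: §1 `s2Fin_of_theta`, §2 `s2PinIota_of_theta`, §3 `s2PinCompact_of_theta`; §4 `s2sharp_of_theta` is the closer's letter body itself (S2♯, conjuncts (a) ∧ (b))
on the theta locus.  So the conventions the PIN organs assert are the ones the in-house theta dictionary satisfies — a kernel-checked regression test of the cut, not a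
payment.  PRINT behind the organs (general `P`): [Rogawski1990 Thm. 14.6.4, §15.3 ¶1 + Thm. 13.3.6 (c) (routing into `Π′(ξ)`); Prop. 15.2.1 (a)(b), §12.3 pp. 174–178
(the pin at `ι`); §14.6 pp. 242–243 (`Π′(ξ_v) = {F_φ}` at the compact places)]; theta locus: [GelbartRogawski1991 (5.1.1), Lem. 5.1.2].

References: [Rogawski1990] J. Rogawski, *Automorphic Representations of Unitary Groups in Three Variables*, Ann. of Math. Stud. 123 (1990), §12.3 pp. 174–178, §13.1
p. 199, Thm. 13.3.6 (c) p. 202, §14.6 pp. 241–246 (Thm. 14.6.4), Prop. 15.2.1 and §15.3 ¶1 pp. 249–251; [GelbartRogawski1991] S. Gelbart, J. Rogawski, *L-functions and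
Fourier–Jacobi coefficients for the unitary group U(3)*, Invent. Math. 105 (1991), §5.1 (5.1.1) p. 465, Lem. 5.1.2 p. 466; [Liu2021] Y. Liu, arXiv:2102.11518, Def. 4.11,
Remark 4.2; [BorelWallach2000] A. Borel, N. Wallach, 2nd ed., VI Thm. 4.11.
-/

-- Mathlib idiom (as in ★ `CohDiscreteMemXiFamilyArchPinned`, ★ `F0P3CohClassRoutingCot`): the commutator bracket on `Module.End ℂ M`, needed to MENTION
-- `(uFormGroup (Fin 2) (Fin 1)).lie →ₗ⁅ℝ⁆ Module.End ℂ M` in the organ texts (the `(𝔤,K)`-token binders are restated token for token; no Lines import is allowed).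
attribute [local instance 100] LieRing.ofAssociativeRing

set_option autoImplicit false
-- the mandated namespace repeats `HodgeConjecture.HodgeConjecture`, as in every `Theorems/*.lean` of this sub-problem
set_option linter.dupNamespace false

noncomputable section

open scoped Matrix Kronecker MatrixGroups MonoidAlgebra ComplexOrder
open NumberField NumberField.InfinitePlace IsDedekindDomain MeasureTheory
open Literature.NumberTheory Literature.NumberTheory.Automorphic Literature.NumberTheory.Automorphic.UnitaryGroup
open Literature.NumberTheory.Automorphic.UnitaryGroup.CotangentForms
open Literature.NumberTheory.Automorphic.IdeleClassGroup
open Literature.NumberTheory.Automorphic.Liu2021 Literature.NumberTheory.Automorphic.Liu2021.AppendixC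
open Literature.NumberTheory.Automorphic.Liu2021.Def411WeilCarriers
open Literature.NumberTheory.Automorphic.Liu2021.Def411WeilCarriersDoubling
open Literature.NumberTheory.GelbartRogawski1991 Literature.NumberTheory.GelbartRogawski1991.UnitaryDualPair
open Literature.NumberTheory.GelbartRogawski1991.UnitaryDualPair.WeilCoinv
open Literature.NumberTheory.GelbartRogawski1991.UnitaryDualPair.LocalSplitting
open Literature.RepresentationTheory Literature.RepresentationTheory.Liu2021
open Literature.NumberTheory.GaloisRepresentations Literature.RepresentationTheory.HarrisKudlaSweet1996
open Literature.NumberTheory.Rogawski1990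
open Literature.RepresentationTheory.BorelWallach2000 Literature.RepresentationTheory.KonnoKonno2007
open Literature.RepresentationTheory.KonnoKonno2007.RealDualPair Literature.RepresentationTheory.KonnoKonno2007.RealDualPair.UForm
open Summit.HodgeConjecture.CorCM
open Summit.HodgeConjecture.HodgeConjecture.Cruxes.H413.F0P3XiArchDataOfRecord (archTypeOfRecord hasUnitaryArchType_archTypeOfRecord)
open Summit.HodgeConjecture.HodgeConjecture.Cruxes.H413.F0P3cXiArchPinnedOfThetaDictionary (stubS2sharpTheta_archPinned)
open Summit.HodgeConjecture.HodgeConjecture.Cruxes.H413.F0P3cMemXiFamilyRigidOfCot (memXiFamily_rigid_of_isCot)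

namespace Summit.HodgeConjecture.HodgeConjecture.Cruxes.H413.F0P3cS2SharpOrgansOfTheta

/-! ## §1 ORGAN FIN on the theta locus -/

/-- **ORGAN FIN HOLDS ON THE THETA LOCUS.**  The LEAF's `S2FinLetter` text with the theta binders (`e₁ dV hdV hdV0 g hg ιV hιV`, `μ hμ`, `HasWeight L μ 1`, `a χ`,
`P.HasFinComponent (rhoAtLine … ιV a χ)`) inserted after `P`, otherwise token for token (measure spelled `μA`): `∃ ξ, MemXiFamily P … μω hμu ξ`.  One line over ★
`stubS2sharpTheta_archPinned` (conjunct (a); = ★ p845234 `stubS2sharpTheta_holds`); the cotangent ∕ `K_c` ∕ token hypotheses are idle on this locus.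
[cite: GelbartRogawski1991, §5.1 (5.1.1) p. 465, Lem. 5.1.2 p. 466] [cite: Rogawski1990, §13.1 p. 199; §14.6 Thm. 14.6.4 (p. 243)] -/
theorem s2Fin_of_theta :
  ∀ (L : Type) [Field L] [NumberField L] [IsCMField L] (ι : L →+* ℂ) (H : Matrix (Fin 3) (Fin 3) L) (T : GL (Fin 3) ℂ)
    (hT : (T : Matrix (Fin 3) (Fin 3) ℂ)ᴴ * H.map ι * (T : Matrix (Fin 3) (Fin 3) ℂ) = Literature.Geometry.ComplexHyperbolic.BallModel.J),
    (∀ τ' : L →+* ℂ, InfinitePlace.mk τ' ≠ InfinitePlace.mk ι → (H.map τ').PosDef) → 2 ≤ Module.finrank ℚ ↥(maximalRealSubfield L) →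
    ∀ {n' : ℕ} (e₁ : Fin 3 × Fin 1 ≃ Fin n') (dV : Fin 3 → L) (hdV : ∀ i, IsCMField.complexConj L (dV i) = dV i)
      (hdV0 : ∀ i, dV i ≠ 0) (g : GL (Fin 3) L)
      (hg : ((g : Matrix (Fin 3) (Fin 3) L).map (cmConjRingHom L))ᵀ * H * (g : Matrix (Fin 3) (Fin 3) L) = Matrix.diagonal dV)
      (ιV : finAdelic (↥(maximalRealSubfield L)) L (IsCMField.complexConj L) 3 H →*
          finAdelic (↥(maximalRealSubfield L)) L (IsCMField.complexConj L) 3 (Matrix.diagonal dV)),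
        (∀ k, ((ιV k : finAdelic (↥(maximalRealSubfield L)) L (IsCMField.complexConj L) 3 (Matrix.diagonal dV)) :
            GL (Fin 3) (FiniteAdeleRing (𝓞 L) L)) =
          (toFinAdeleGL L 3 g)⁻¹ * (k : GL (Fin 3) (FiniteAdeleRing (𝓞 L) L)) * toFinAdeleGL L 3 g) →
        ∀ (μA : Measure (adelicGroupData (↥(maximalRealSubfield L)) L (IsCMField.complexConj L) 3 H).automorphicQuotient)
          [(adelicGroupData (↥(maximalRealSubfield L)) L (IsCMField.complexConj L) 3 H).IsAutomorphicMeasure μA]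
          (μω : HeckeCharacter L) (hμu : μω.IsUnitary),
          (∀ x : Literature.NumberTheory.GaloisRepresentations.ideleGroup ↥(maximalRealSubfield L),
            μω (AdeleRing.ideleBaseChange (↥(maximalRealSubfield L)) L x) = quadraticHeckeCharCM L x) →
        ∀ (P : DiscreteAutomorphicRep (adelicGroupData (↥(maximalRealSubfield L)) L (IsCMField.complexConj L) 3 H) μA)
          (μ : Literature.NumberTheory.Automorphic.IdeleClassGroup L →ₜ* Circle) (hμ : IsConjugateSymplectic L μ), HasWeight L μ 1 →
          ∀ (a : (↥(maximalRealSubfield L))ˣ) (χ : Chi (↥(maximalRealSubfield L)) L (IsCMField.complexConj L)),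
            P.HasFinComponent
              (rhoAtLine (↥(maximalRealSubfield L)) L (IsCMField.complexConj L) 3 e₁ (Matrix.diagonal dV)
                (complexConj_imagUnit L) (imagUnit_ne_zero L) (imagUnit_mul_self L) (realDiagonal_isSymm L dV hdV)
                (isUnit_det_realDiagonal L dV hdV hdV0) (realDiagonal_map L dV hdV).symm
                (fun a => isCompatible_chiSplittingLine L e₁ dV hdV hdV0 (toHeckeCharacter L μ)
                  (isUnitary_toHeckeCharacter L μ) ((isOscillatorChar_toHeckeCharacter_iff μ).mpr hμ)
                  (TW (↥(maximalRealSubfield L)) a) (isSymm_TW (↥(maximalRealSubfield L)) a)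
                  (isUnit_det_TW (↥(maximalRealSubfield L)) a) (JW (↥(maximalRealSubfield L)) L a)
                  (JW_eq (↥(maximalRealSubfield L)) L a)) ιV a χ) →
          (P.IsHolCotangentAt (cmArchSection L ι H T hT) (cmCompactFactor L ι H T hT) ∨
            P.IsAntiholCotangentAt (cmArchSection L ι H T hT) (cmCompactFactor L ι H T hT)) →
          (∀ k : (adelicGroupData (↥(maximalRealSubfield L)) L (IsCMField.complexConj L) 3 H).Adelic, k ∈ cmCompactFactor L ι H T hT →
            ∀ v : P.space.toSubmodule, (adelicGroupData (↥(maximalRealSubfield L)) L (IsCMField.complexConj L) 3 H).rightRegular μA k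
              (v : (adelicGroupData (↥(maximalRealSubfield L)) L (IsCMField.complexConj L) 3 H).L2 μA) = v) →
          ∀ (M : Type) [AddCommGroup M] [Module ℂ M]
            (σK : Representation ℂ (uFormGroup (Fin 2) (Fin 1)).maximalCompact M) (σ𝔤 : (uFormGroup (Fin 2) (Fin 1)).lie →ₗ⁅ℝ⁆ Module.End ℂ M)
            (hM : IsGKModule (uFormGroup (Fin 2) (Fin 1)) σK σ𝔤), IsIrreducibleGK σK σ𝔤 →
            (∃ T₁ : P.archModuleCM ι T hT →ₗ[ℂ] M,
              (∀ (k : (uFormGroup (Fin 2) (Fin 1)).maximalCompact) (w : P.archModuleCM ι T hT), T₁ (P.archRepKCM ι T hT k w) = σK k (T₁ w)) ∧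
                (∀ (X : (uFormGroup (Fin 2) (Fin 1)).lie) (w : P.archModuleCM ι T hT), T₁ (P.archRepLieCM ι T hT X w) = σ𝔤 X (T₁ w)) ∧ T₁ ≠ 0) →
            ∀ δ : ℤ, (δ = 1 ∨ δ = -1) → upqTypeClasses σK σ𝔤 hM.ad_compat 1 δ ≠ ⊥ →
              ∃ ξ : OneDimAutRepH L,
                MemXiFamily P (transpose_map_cmConjRingHom_eq_of_frame L ι H T hT) (isUnit_det_of_frame L ι H T hT) μω hμu ξ := by
  intro L _ _ _ ι H T hT hdef h2 n' e₁ dV hdV hdV0 g hg ιV hιV μA _ μω hμu hquad P μ hμ hw a χ hfin _hP _hKc _M _ _ _σK _σ𝔤 _hM _hirr _htok _δ _hδ _hne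
  obtain ⟨ξ, hmem, -⟩ := stubS2sharpTheta_archPinned L ι H T hT hdef h2 e₁ dV hdV hdV0 g hg ιV hιV μA P μω hμu hquad μ hμ hw a χ hfin
  exact ⟨ξ, hmem⟩

/-! ## §2 ORGAN PIN-ι on the theta locus -/

/-- **ORGAN PIN-ι HOLDS ON THE THETA LOCUS.**  The LEAF's `S2PinIotaLetter` text with the theta binders inserted after `P`, otherwise token for token: for a
cotangent theta-`P` with the `(𝔤,K)`-token, EVERY `ξ` with `MemXiFamily P … μω hμu ξ` satisfies `ξ.IsCohTrivialAt (tOfArchType (archTypeOfRecord μω) ι) ι`.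
PROOF: ★ `stubS2sharpTheta_archPinned` gives the dictionary `ξ₀` in the family of `P`, pinned at every unitary type of `μω` and every embedding; U♭-cot ★
`memXiFamily_rigid_of_isCot` gives `ξ = ξ₀`; read the pin at `k₀ = archTypeOfRecord μω` (★ `hasUnitaryArchType_archTypeOfRecord`) and at `ι`.  The token binders are idle
on this locus.  (General `P`: rung-5 print — `P ∈ Π′(ξ)`, `P_ι ∈ {J^±_φ}`, `φ = φ(1,0,−1)`.)
[cite: Rogawski1990, Prop. 15.2.1 (a)(b) (p. 249); §12.3 pp. 174–178 (Prop. 12.3.3 p. 178); §14.6 Thm. 14.6.4 (p. 243); §13.1 p. 199] [cite: GelbartRogawski1991, §5.1 Lem. 5.1.2 p. 466]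
[cite: Liu2021, Remark 4.2] -/
theorem s2PinIota_of_theta :
  ∀ (L : Type) [Field L] [NumberField L] [IsCMField L] (ι : L →+* ℂ) (H : Matrix (Fin 3) (Fin 3) L) (T : GL (Fin 3) ℂ)
    (hT : (T : Matrix (Fin 3) (Fin 3) ℂ)ᴴ * H.map ι * (T : Matrix (Fin 3) (Fin 3) ℂ) = Literature.Geometry.ComplexHyperbolic.BallModel.J),
    (∀ τ' : L →+* ℂ, InfinitePlace.mk τ' ≠ InfinitePlace.mk ι → (H.map τ').PosDef) → 2 ≤ Module.finrank ℚ ↥(maximalRealSubfield L) →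
    ∀ {n' : ℕ} (e₁ : Fin 3 × Fin 1 ≃ Fin n') (dV : Fin 3 → L) (hdV : ∀ i, IsCMField.complexConj L (dV i) = dV i)
      (hdV0 : ∀ i, dV i ≠ 0) (g : GL (Fin 3) L)
      (hg : ((g : Matrix (Fin 3) (Fin 3) L).map (cmConjRingHom L))ᵀ * H * (g : Matrix (Fin 3) (Fin 3) L) = Matrix.diagonal dV)
      (ιV : finAdelic (↥(maximalRealSubfield L)) L (IsCMField.complexConj L) 3 H →*
          finAdelic (↥(maximalRealSubfield L)) L (IsCMField.complexConj L) 3 (Matrix.diagonal dV)),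
        (∀ k, ((ιV k : finAdelic (↥(maximalRealSubfield L)) L (IsCMField.complexConj L) 3 (Matrix.diagonal dV)) :
            GL (Fin 3) (FiniteAdeleRing (𝓞 L) L)) =
          (toFinAdeleGL L 3 g)⁻¹ * (k : GL (Fin 3) (FiniteAdeleRing (𝓞 L) L)) * toFinAdeleGL L 3 g) →
        ∀ (μA : Measure (adelicGroupData (↥(maximalRealSubfield L)) L (IsCMField.complexConj L) 3 H).automorphicQuotient)
          [(adelicGroupData (↥(maximalRealSubfield L)) L (IsCMField.complexConj L) 3 H).IsAutomorphicMeasure μA]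
          (μω : HeckeCharacter L) (hμu : μω.IsUnitary),
          (∀ x : Literature.NumberTheory.GaloisRepresentations.ideleGroup ↥(maximalRealSubfield L),
            μω (AdeleRing.ideleBaseChange (↥(maximalRealSubfield L)) L x) = quadraticHeckeCharCM L x) →
        ∀ (P : DiscreteAutomorphicRep (adelicGroupData (↥(maximalRealSubfield L)) L (IsCMField.complexConj L) 3 H) μA)
          (μ : Literature.NumberTheory.Automorphic.IdeleClassGroup L →ₜ* Circle) (hμ : IsConjugateSymplectic L μ), HasWeight L μ 1 →
          ∀ (a : (↥(maximalRealSubfield L))ˣ) (χ : Chi (↥(maximalRealSubfield L)) L (IsCMField.complexConj L)),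
            P.HasFinComponent
              (rhoAtLine (↥(maximalRealSubfield L)) L (IsCMField.complexConj L) 3 e₁ (Matrix.diagonal dV)
                (complexConj_imagUnit L) (imagUnit_ne_zero L) (imagUnit_mul_self L) (realDiagonal_isSymm L dV hdV)
                (isUnit_det_realDiagonal L dV hdV hdV0) (realDiagonal_map L dV hdV).symm
                (fun a => isCompatible_chiSplittingLine L e₁ dV hdV hdV0 (toHeckeCharacter L μ)
                  (isUnitary_toHeckeCharacter L μ) ((isOscillatorChar_toHeckeCharacter_iff μ).mpr hμ)
                  (TW (↥(maximalRealSubfield L)) a) (isSymm_TW (↥(maximalRealSubfield L)) a)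
                  (isUnit_det_TW (↥(maximalRealSubfield L)) a) (JW (↥(maximalRealSubfield L)) L a)
                  (JW_eq (↥(maximalRealSubfield L)) L a)) ιV a χ) →
          (P.IsHolCotangentAt (cmArchSection L ι H T hT) (cmCompactFactor L ι H T hT) ∨
            P.IsAntiholCotangentAt (cmArchSection L ι H T hT) (cmCompactFactor L ι H T hT)) →
          ∀ (M : Type) [AddCommGroup M] [Module ℂ M]
            (σK : Representation ℂ (uFormGroup (Fin 2) (Fin 1)).maximalCompact M) (σ𝔤 : (uFormGroup (Fin 2) (Fin 1)).lie →ₗ⁅ℝ⁆ Module.End ℂ M)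
            (hM : IsGKModule (uFormGroup (Fin 2) (Fin 1)) σK σ𝔤), IsIrreducibleGK σK σ𝔤 →
            (∃ T₁ : P.archModuleCM ι T hT →ₗ[ℂ] M,
              (∀ (k : (uFormGroup (Fin 2) (Fin 1)).maximalCompact) (w : P.archModuleCM ι T hT), T₁ (P.archRepKCM ι T hT k w) = σK k (T₁ w)) ∧
                (∀ (X : (uFormGroup (Fin 2) (Fin 1)).lie) (w : P.archModuleCM ι T hT), T₁ (P.archRepLieCM ι T hT X w) = σ𝔤 X (T₁ w)) ∧ T₁ ≠ 0) →
            ∀ δ : ℤ, (δ = 1 ∨ δ = -1) → upqTypeClasses σK σ𝔤 hM.ad_compat 1 δ ≠ ⊥ →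
              ∀ ξ : OneDimAutRepH L,
                MemXiFamily P (transpose_map_cmConjRingHom_eq_of_frame L ι H T hT) (isUnit_det_of_frame L ι H T hT) μω hμu ξ →
                  ξ.IsCohTrivialAt (ArchSignRecipe.tOfArchType (archTypeOfRecord μω) ι) ι := by
  intro L _ _ _ ι H T hT hdef h2 n' e₁ dV hdV hdV0 g hg ιV hιV μA _ μω hμu hquad P μ hμ hw a χ hfin hP _M _ _ _σK _σ𝔤 _hM _hirr _htok _δ _hδ _hne ξ hmem
  obtain ⟨ξ₀, hmem₀, hall⟩ := stubS2sharpTheta_archPinned L ι H T hT hdef h2 e₁ dV hdV hdV0 g hg ιV hιV μA P μω hμu hquad μ hμ hw a χ hfin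
  obtain rfl : ξ = ξ₀ := memXiFamily_rigid_of_isCot ι H T hT hdef h2 μω hμu P hP ξ ξ₀ hmem hmem₀
  exact hall _ (hasUnitaryArchType_archTypeOfRecord μω hμu hquad) ι

/-! ## §3 ORGAN PIN-τ on the theta locus -/

/-- **ORGAN PIN-τ HOLDS ON THE THETA LOCUS.**  The LEAF's `S2PinCompactLetter` text with the theta binders inserted after `P`, otherwise token for token: for a
cotangent, `K_c`-trivial theta-`P`, EVERY `ξ` with `MemXiFamily P … μω hμu ξ` satisfies `ξ.IsCohTrivialAt (tOfArchType (archTypeOfRecord μω) τ) τ` at every embedding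
`τ` off the place of `ι`.  PROOF: as §2 (★ `stubS2sharpTheta_archPinned` pins the dictionary `ξ₀` at EVERY embedding; U♭-cot ★ `memXiFamily_rigid_of_isCot`; ★
`hasUnitaryArchType_archTypeOfRecord`); `K_c`-triviality and `mk τ ≠ mk ι` are idle on this locus.  (General `P`: rung-5 print — `Π′(ξ_τ) = {F_φ}` at the compact places,
`P_τ = 𝟙 ⇒ F_φ = 𝟙 ⇒ φ = φ(1,0,−1)`.)
[cite: Rogawski1990, §14.6 pp. 242–243 and Thm. 14.6.4 (p. 243); §12.3 p. 176 and p. 178; §13.1 p. 199] [cite: GelbartRogawski1991, §5.1 Lem. 5.1.2 p. 466] [cite: Liu2021, Remark 4.2] -/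
theorem s2PinCompact_of_theta :
  ∀ (L : Type) [Field L] [NumberField L] [IsCMField L] (ι : L →+* ℂ) (H : Matrix (Fin 3) (Fin 3) L) (T : GL (Fin 3) ℂ)
    (hT : (T : Matrix (Fin 3) (Fin 3) ℂ)ᴴ * H.map ι * (T : Matrix (Fin 3) (Fin 3) ℂ) = Literature.Geometry.ComplexHyperbolic.BallModel.J),
    (∀ τ' : L →+* ℂ, InfinitePlace.mk τ' ≠ InfinitePlace.mk ι → (H.map τ').PosDef) → 2 ≤ Module.finrank ℚ ↥(maximalRealSubfield L) →
    ∀ {n' : ℕ} (e₁ : Fin 3 × Fin 1 ≃ Fin n') (dV : Fin 3 → L) (hdV : ∀ i, IsCMField.complexConj L (dV i) = dV i)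
      (hdV0 : ∀ i, dV i ≠ 0) (g : GL (Fin 3) L)
      (hg : ((g : Matrix (Fin 3) (Fin 3) L).map (cmConjRingHom L))ᵀ * H * (g : Matrix (Fin 3) (Fin 3) L) = Matrix.diagonal dV)
      (ιV : finAdelic (↥(maximalRealSubfield L)) L (IsCMField.complexConj L) 3 H →*
          finAdelic (↥(maximalRealSubfield L)) L (IsCMField.complexConj L) 3 (Matrix.diagonal dV)),
        (∀ k, ((ιV k : finAdelic (↥(maximalRealSubfield L)) L (IsCMField.complexConj L) 3 (Matrix.diagonal dV)) :
            GL (Fin 3) (FiniteAdeleRing (𝓞 L) L)) =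
          (toFinAdeleGL L 3 g)⁻¹ * (k : GL (Fin 3) (FiniteAdeleRing (𝓞 L) L)) * toFinAdeleGL L 3 g) →
        ∀ (μA : Measure (adelicGroupData (↥(maximalRealSubfield L)) L (IsCMField.complexConj L) 3 H).automorphicQuotient)
          [(adelicGroupData (↥(maximalRealSubfield L)) L (IsCMField.complexConj L) 3 H).IsAutomorphicMeasure μA]
          (μω : HeckeCharacter L) (hμu : μω.IsUnitary),
          (∀ x : Literature.NumberTheory.GaloisRepresentations.ideleGroup ↥(maximalRealSubfield L),
            μω (AdeleRing.ideleBaseChange (↥(maximalRealSubfield L)) L x) = quadraticHeckeCharCM L x) →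
        ∀ (P : DiscreteAutomorphicRep (adelicGroupData (↥(maximalRealSubfield L)) L (IsCMField.complexConj L) 3 H) μA)
          (μ : Literature.NumberTheory.Automorphic.IdeleClassGroup L →ₜ* Circle) (hμ : IsConjugateSymplectic L μ), HasWeight L μ 1 →
          ∀ (a : (↥(maximalRealSubfield L))ˣ) (χ : Chi (↥(maximalRealSubfield L)) L (IsCMField.complexConj L)),
            P.HasFinComponent
              (rhoAtLine (↥(maximalRealSubfield L)) L (IsCMField.complexConj L) 3 e₁ (Matrix.diagonal dV)
                (complexConj_imagUnit L) (imagUnit_ne_zero L) (imagUnit_mul_self L) (realDiagonal_isSymm L dV hdV)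
                (isUnit_det_realDiagonal L dV hdV hdV0) (realDiagonal_map L dV hdV).symm
                (fun a => isCompatible_chiSplittingLine L e₁ dV hdV hdV0 (toHeckeCharacter L μ)
                  (isUnitary_toHeckeCharacter L μ) ((isOscillatorChar_toHeckeCharacter_iff μ).mpr hμ)
                  (TW (↥(maximalRealSubfield L)) a) (isSymm_TW (↥(maximalRealSubfield L)) a)
                  (isUnit_det_TW (↥(maximalRealSubfield L)) a) (JW (↥(maximalRealSubfield L)) L a)
                  (JW_eq (↥(maximalRealSubfield L)) L a)) ιV a χ) →
          (P.IsHolCotangentAt (cmArchSection L ι H T hT) (cmCompactFactor L ι H T hT) ∨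
            P.IsAntiholCotangentAt (cmArchSection L ι H T hT) (cmCompactFactor L ι H T hT)) →
          (∀ k : (adelicGroupData (↥(maximalRealSubfield L)) L (IsCMField.complexConj L) 3 H).Adelic, k ∈ cmCompactFactor L ι H T hT →
            ∀ v : P.space.toSubmodule, (adelicGroupData (↥(maximalRealSubfield L)) L (IsCMField.complexConj L) 3 H).rightRegular μA k
              (v : (adelicGroupData (↥(maximalRealSubfield L)) L (IsCMField.complexConj L) 3 H).L2 μA) = v) →
          ∀ ξ : OneDimAutRepH L,
            MemXiFamily P (transpose_map_cmConjRingHom_eq_of_frame L ι H T hT) (isUnit_det_of_frame L ι H T hT) μω hμu ξ →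
              ∀ τ : L →+* ℂ, InfinitePlace.mk τ ≠ InfinitePlace.mk ι →
                ξ.IsCohTrivialAt (ArchSignRecipe.tOfArchType (archTypeOfRecord μω) τ) τ := by
  intro L _ _ _ ι H T hT hdef h2 n' e₁ dV hdV hdV0 g hg ιV hιV μA _ μω hμu hquad P μ hμ hw a χ hfin hP _hKc ξ hmem τ _hτ
  obtain ⟨ξ₀, hmem₀, hall⟩ := stubS2sharpTheta_archPinned L ι H T hT hdef h2 e₁ dV hdV hdV0 g hg ιV hιV μA P μω hμu hquad μ hμ hw a χ hfin
  obtain rfl : ξ = ξ₀ := memXiFamily_rigid_of_isCot ι H T hT hdef h2 μω hμu P hP ξ ξ₀ hmem hmem₀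
  exact hall _ (hasUnitaryArchType_archTypeOfRecord μω hμu hquad) τ

/-! ## §4 The closer's letter body S2♯ on the theta locus -/

/-- **S2♯'S BODY HOLDS ON THE THETA LOCUS.**  The text of ★ `Rogawski1990.cohDiscrete_memXiFamily_archPinned` (#80; conjuncts (a) `MemXiFamily` ∧ (b) the pin at every
unitary type `k` of `μω` and every embedding) with the theta binders inserted after `P`, otherwise token for token — hypothesis-free; = ★ `stubS2sharpTheta_archPinned`
with the letter's cotangent ∕ `K_c` ∕ token binders (idle here).  Equivalently FIN ∧ PIN-ι ∧ PIN-τ on the theta locus via the LEAF's head.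
[cite: Rogawski1990, §14.6 Thm. 14.6.4 (p. 243); Prop. 15.2.1 (b) (p. 249); §12.3 pp. 174–178; §14.6 pp. 242–243] [cite: GelbartRogawski1991, §5.1 (5.1.1) p. 465, Lem. 5.1.2 p. 466]
[cite: Liu2021, Remark 4.2] -/
theorem s2sharp_of_theta :
  ∀ (L : Type) [Field L] [NumberField L] [IsCMField L] (ι : L →+* ℂ) (H : Matrix (Fin 3) (Fin 3) L) (T : GL (Fin 3) ℂ)
    (hT : (T : Matrix (Fin 3) (Fin 3) ℂ)ᴴ * H.map ι * (T : Matrix (Fin 3) (Fin 3) ℂ) = Literature.Geometry.ComplexHyperbolic.BallModel.J),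
    (∀ τ' : L →+* ℂ, InfinitePlace.mk τ' ≠ InfinitePlace.mk ι → (H.map τ').PosDef) → 2 ≤ Module.finrank ℚ ↥(maximalRealSubfield L) →
    ∀ {n' : ℕ} (e₁ : Fin 3 × Fin 1 ≃ Fin n') (dV : Fin 3 → L) (hdV : ∀ i, IsCMField.complexConj L (dV i) = dV i)
      (hdV0 : ∀ i, dV i ≠ 0) (g : GL (Fin 3) L)
      (hg : ((g : Matrix (Fin 3) (Fin 3) L).map (cmConjRingHom L))ᵀ * H * (g : Matrix (Fin 3) (Fin 3) L) = Matrix.diagonal dV)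
      (ιV : finAdelic (↥(maximalRealSubfield L)) L (IsCMField.complexConj L) 3 H →*
          finAdelic (↥(maximalRealSubfield L)) L (IsCMField.complexConj L) 3 (Matrix.diagonal dV)),
        (∀ k, ((ιV k : finAdelic (↥(maximalRealSubfield L)) L (IsCMField.complexConj L) 3 (Matrix.diagonal dV)) :
            GL (Fin 3) (FiniteAdeleRing (𝓞 L) L)) =
          (toFinAdeleGL L 3 g)⁻¹ * (k : GL (Fin 3) (FiniteAdeleRing (𝓞 L) L)) * toFinAdeleGL L 3 g) →
        ∀ (μA : Measure (adelicGroupData (↥(maximalRealSubfield L)) L (IsCMField.complexConj L) 3 H).automorphicQuotient)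
          [(adelicGroupData (↥(maximalRealSubfield L)) L (IsCMField.complexConj L) 3 H).IsAutomorphicMeasure μA]
          (μω : HeckeCharacter L) (hμu : μω.IsUnitary),
          (∀ x : Literature.NumberTheory.GaloisRepresentations.ideleGroup ↥(maximalRealSubfield L),
            μω (AdeleRing.ideleBaseChange (↥(maximalRealSubfield L)) L x) = quadraticHeckeCharCM L x) →
        ∀ (P : DiscreteAutomorphicRep (adelicGroupData (↥(maximalRealSubfield L)) L (IsCMField.complexConj L) 3 H) μA)
          (μ : Literature.NumberTheory.Automorphic.IdeleClassGroup L →ₜ* Circle) (hμ : IsConjugateSymplectic L μ), HasWeight L μ 1 →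
          ∀ (a : (↥(maximalRealSubfield L))ˣ) (χ : Chi (↥(maximalRealSubfield L)) L (IsCMField.complexConj L)),
            P.HasFinComponent
              (rhoAtLine (↥(maximalRealSubfield L)) L (IsCMField.complexConj L) 3 e₁ (Matrix.diagonal dV)
                (complexConj_imagUnit L) (imagUnit_ne_zero L) (imagUnit_mul_self L) (realDiagonal_isSymm L dV hdV)
                (isUnit_det_realDiagonal L dV hdV hdV0) (realDiagonal_map L dV hdV).symm
                (fun a => isCompatible_chiSplittingLine L e₁ dV hdV hdV0 (toHeckeCharacter L μ)
                  (isUnitary_toHeckeCharacter L μ) ((isOscillatorChar_toHeckeCharacter_iff μ).mpr hμ)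
                  (TW (↥(maximalRealSubfield L)) a) (isSymm_TW (↥(maximalRealSubfield L)) a)
                  (isUnit_det_TW (↥(maximalRealSubfield L)) a) (JW (↥(maximalRealSubfield L)) L a)
                  (JW_eq (↥(maximalRealSubfield L)) L a)) ιV a χ) →
          (P.IsHolCotangentAt (cmArchSection L ι H T hT) (cmCompactFactor L ι H T hT) ∨
            P.IsAntiholCotangentAt (cmArchSection L ι H T hT) (cmCompactFactor L ι H T hT)) →
          (∀ k : (adelicGroupData (↥(maximalRealSubfield L)) L (IsCMField.complexConj L) 3 H).Adelic, k ∈ cmCompactFactor L ι H T hT →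
            ∀ v : P.space.toSubmodule, (adelicGroupData (↥(maximalRealSubfield L)) L (IsCMField.complexConj L) 3 H).rightRegular μA k
              (v : (adelicGroupData (↥(maximalRealSubfield L)) L (IsCMField.complexConj L) 3 H).L2 μA) = v) →
          ∀ (M : Type) [AddCommGroup M] [Module ℂ M]
            (σK : Representation ℂ (uFormGroup (Fin 2) (Fin 1)).maximalCompact M) (σ𝔤 : (uFormGroup (Fin 2) (Fin 1)).lie →ₗ⁅ℝ⁆ Module.End ℂ M)
            (hM : IsGKModule (uFormGroup (Fin 2) (Fin 1)) σK σ𝔤), IsIrreducibleGK σK σ𝔤 →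
            (∃ T₁ : P.archModuleCM ι T hT →ₗ[ℂ] M,
              (∀ (k : (uFormGroup (Fin 2) (Fin 1)).maximalCompact) (w : P.archModuleCM ι T hT), T₁ (P.archRepKCM ι T hT k w) = σK k (T₁ w)) ∧
                (∀ (X : (uFormGroup (Fin 2) (Fin 1)).lie) (w : P.archModuleCM ι T hT), T₁ (P.archRepLieCM ι T hT X w) = σ𝔤 X (T₁ w)) ∧ T₁ ≠ 0) →
            ∀ δ : ℤ, (δ = 1 ∨ δ = -1) → upqTypeClasses σK σ𝔤 hM.ad_compat 1 δ ≠ ⊥ →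
              ∃ ξ : OneDimAutRepH L, MemXiFamily P (transpose_map_cmConjRingHom_eq_of_frame L ι H T hT) (isUnit_det_of_frame L ι H T hT) μω hμu ξ ∧
                ∀ k : InfinitePlace L → ℤ, μω.HasUnitaryArchType k (fun _ => 0) → ∀ ι' : L →+* ℂ, ξ.IsCohTrivialAt (ArchSignRecipe.tOfArchType k ι') ι' := by
  intro L _ _ _ ι H T hT hdef h2 n' e₁ dV hdV hdV0 g hg ιV hιV μA _ μω hμu hquad P μ hμ hw a χ hfin _hP _hKc _M _ _ _σK _σ𝔤 _hM _hirr _htok _δ _hδ _hne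
  exact stubS2sharpTheta_archPinned L ι H T hT hdef h2 e₁ dV hdV hdV0 g hg ιV hιV μA P μω hμu hquad μ hμ hw a χ hfin

end Summit.HodgeConjecture.HodgeConjecture.Cruxes.H413.F0P3cS2SharpOrgansOfTheta

end
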